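import Summits.QuantumFields.YangMills.Theorems.LuscherReductionTwistedTraceScalingBTTauBudget
import Summits.QuantumFields.YangMills.Theorems.LuscherReductionTwistedTraceScalingBTFibreProfile
import Summits.QuantumFields.YangMills.Theorems.LuscherReductionTwistedTraceScalingBTPointwiseTail
import HarnessLib

/-!
# The (B-T) SCHEDULE of radii and the CONDITIONAL ASSEMBLY: given the finitely many eventual smallness facts about the explicit schedule, the brick (B-T) of the record
# analytic input holds with `Ω = frozenProfile`, `σ = C/Z/γ` (lane A of S-BASE, crux `TwistedTraceScaling` stmt-QuantumFields-20203, C4-CORE, the (B-T) pen; design note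
# `pub/ym-fleet/ym-luscher-20007-p1/COARSE-DESIGN.md` §25.6–§25.9)

Schedule (all in `powScale`, so defined for every `β`): fibre radius `btRad = min(1/40, β^{-1/2})`, Faddeev–Popov radius `btEps = β^{-1}`, near/far threshold `btAlpha = β^{-1/2}·ℓ`,
core jump radius `btR1 = 5β^{-1/2}·ℓ` (`ℓ = max(log β, 1)`), window `δ₁ = recordDelta1 L s`, rough threshold `13δ₁`, quaternion core `btEps/3`, `κ₂ = β^{-1}`.
* `btOmega = frozenProfile L 0 btRad` and its record fields (`btOmega_fields`: measurable, `≤ 1`, colour-blind, supported in the ball, `γ > 0`; `btOmega_nonneg`, `btOmega_support`);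
* ★★★ `recordBT_hT_of_eventually` — IF the smallness hypotheses of `…BTFixedBeta.fixed_beta_estimate` and of `…BTTauBudget.btTau_le` hold EVENTUALLY along the schedule THEN the `hT` field of `RecordAnalyticInput` holds for `Ω = btOmega`, `σ β = btC/fpZ/γ`,
  rate `btKappa(schedule) + β^{-1}` (door `…BTPointwiseTail.hT_of_fp_add` with `W = fpWeight btEps`, `Z = fpZ btEps`).
The two eventual facts are pure real analysis of the schedule (seat NOTES: `BTRates`); they and the `o(bareLambda)` envelope of `btKappa` are what remains of (B-T).
HONEST FRAMING: a stub of a child of the CONDITIONAL reduction route R2b1; C4-CORE OPEN; not infinite volume, not a gap, not Clay.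
-/

set_option autoImplicit false

noncomputable section

open MeasureTheory Filter Topology Real
open scoped BigOperators Matrix Quaternion
open Literature.MathematicalPhysics.QuantumFieldTheory
open Literature.MathematicalPhysics.QuantumLattice

namespace Summit.QuantumFields.YangMills.Theorems.FemtoTransferGap.TwoLattice.ConstTube

open Summit.QuantumFields.YangMills.Theorems.FemtoTransferGap
open Summit.QuantumFields.YangMills.Theorems.FemtoTransferGap.TwoLattice
open Summit.QuantumFields.YangMills.Theorems.FemtoTransferGap.TwoLattice.Avg
open Summit.QuantumFields.YangMills.Theorems.FemtoTransferGap.TwoLattice.Stiff (LinkSpace)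
open Summit.QuantumFields.YangMills.Theorems.FemtoTransferGap.TwoLattice.Cov

variable (L : ℕ) [NeZero L]

/-! ## §1 The schedule -/

/-- `ℓ(β) = max(log β, 1)`. [folklore] -/
def btLog (β : ℝ) : ℝ := max (Real.log β) 1

/-- Fibre radius `min(1/40, β^{-1/2})`. [folklore] -/
def btRad (β : ℝ) : ℝ := min (1 / 40) (powScale (1 / 2) β)

/-- Faddeev–Popov radius `β^{-1}`. [folklore] -/
def btEps (β : ℝ) : ℝ := powScale 1 β

/-- Near/far threshold `β^{-1/2}·ℓ`. [folklore] -/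
def btAlpha (β : ℝ) : ℝ := powScale (1 / 2) β * btLog β

/-- Core jump radius `5β^{-1/2}·ℓ`. [folklore] -/
def btR1 (β : ℝ) : ℝ := 5 * powScale (1 / 2) β * btLog β

/-- **The (B-T) fibre profile of record**: `frozenProfile` with no extra stiff weight and radius `btRad`. [cite: Luscher1983, §3] -/
def btOmega : ℝ → LinkSpace L → ℝ := frozenProfile L (fun _ _ => 0) btRad

/-- **The (B-T) constant of record** `C(β)`. [folklore] -/
def btConst (β : ℝ) : ℝ := btC L β (btOmega L β) (btEps β) (btR1 β)

/-- **The (B-T) relative rate of record**: schedule value of `btKappa`, plus the tail rate `β^{-1}`, plus the dominating envelope `β^{-2s}ℓ⁵` (for `hκ_dom`). [folklore] -/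
def btRate (s β : ℝ) : ℝ :=
  btKappa L β (recordDelta1 L s β) (btAlpha β) (9 * L * btR1 β + btEps β) (btRad β) (btEps β * Fintype.card (Site 3 L)) ((L : ℝ) ^ 3 * (12 * recordDelta1 L s β ^ 4)) +
    powScale 1 β + powScale (2 * s) β * btLog β ^ 5

/-- **The slow factor of record** `σ(β) = C/Z/γ`. [folklore] -/
def btSlow (β : ℝ) : ℝ := btConst L β / fpZ (btEps β) / recordGamma L (btOmega L) β

variable {L}

/-! ## §2 Elementary facts about the schedule -/

omit [NeZero L] in
/-- `1 ≤ ℓ`. [folklore] -/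
theorem one_le_btLog (β : ℝ) : 1 ≤ btLog β := le_max_right _ _

omit [NeZero L] in
/-- `0 < btRad ≤ 1/40`. [folklore] -/
theorem btRad_pos_le (β : ℝ) : 0 < btRad β ∧ btRad β ≤ 1 / 40 := ⟨lt_min (by norm_num) (powScale_pos _ _), min_le_left _ _⟩

omit [NeZero L] in
/-- `0 < btEps ≤ 1`. [folklore] -/
theorem btEps_pos_le (β : ℝ) : 0 < btEps β ∧ btEps β ≤ 1 := ⟨powScale_pos _ _, powScale_le_one zero_le_one β⟩

omit [NeZero L] in
/-- `0 ≤ btAlpha`. [folklore] -/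
theorem btAlpha_nonneg (β : ℝ) : 0 ≤ btAlpha β := mul_nonneg (powScale_pos _ _).le (le_trans zero_le_one (one_le_btLog β))

/-! ## §3 The profile of record -/

/-- The record fields of `btOmega`: measurable, `|·| ≤ 1`, colour-blind, supported in the ball of radius `btRad`, and `γ > 0`. [cite: Luscher1983, §3] -/
theorem btOmega_fields :
    (∀ β, Measurable (btOmega L β)) ∧ (∀ β x, |btOmega L β x| ≤ 1) ∧ (∀ β (g : SU2) (x : LinkSpace L), btOmega L β (adL L g x) = btOmega L β x) ∧
      (∀ β x, btOmega L β x ≠ 0 → ‖x‖ ≤ btRad β) ∧ (∀ β, 0 < recordGamma L (btOmega L) β) :=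
  frozenProfile_fields (q := fun _ _ => 0) (fun _ => measurable_const) (fun _ _ => le_rfl) (fun _ _ _ => rfl) fun β => (btRad_pos_le β).1

/-- `btOmega ≥ 0`. [folklore] -/
theorem btOmega_nonneg (β : ℝ) (x : LinkSpace L) : 0 ≤ btOmega L β x := (frozenProfile_mem_Icc (q := fun _ _ => 0) (fun _ _ => le_rfl) btRad β x).1

/-- Support of `btOmega` in fibre coordinates: `|v_{e,c}| ≤ btRad` and `‖v̂‖ ≤ btRad`. [folklore] -/
theorem btOmega_support (β : ℝ) (v : Edge 3 L → Fin 3 → ℝ) (hv : btOmega L β (linkEmbed L v) ≠ 0) :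
    (∀ (e : Edge 3 L) (c : Fin 3), |v e c| ≤ btRad β) ∧ ‖linkEmbed L v‖ ≤ btRad β := by
  have h := btOmega_fields.2.2.2.1 β _ hv
  exact ⟨fun e c => by have := abs_apply_le_norm (linkEmbed L v) e c; rw [linkEmbed_apply] at this; exact this.trans h, h⟩

/-! ## §4 ★★★ The conditional assembly of (B-T) -/

/-- ★★★ **(B-T) FROM THE TWO EVENTUAL SCHEDULE FACTS.** [cite: Luscher1983, §3] -/
theorem recordBT_hT_of_eventually {s : ℝ} (hs : 0 < s)
    (hsmall : ∀ᶠ β : ℝ in atTop, 0 ≤ β ∧ recordDelta1 L s β ≤ 1 / 2 ∧ btAlpha β ≤ 1 ∧ btRad β ≤ 9 * L * btR1 β + btEps β ∧ 9 * L * btR1 β + btEps β ≤ 1 / 30 ∧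
      (L : ℝ) ^ 3 * (12 * recordDelta1 L s β ^ 4) < 2 ∧
      coreEps1 L β (recordDelta1 L s β) (9 * L * btR1 β + btEps β) (btRad β) +
          coreEps2 L β (recordDelta1 L s β) (9 * L * btR1 β + btEps β) (btRad β) ((L : ℝ) ^ 3 * (12 * recordDelta1 L s β ^ 4)) ≤ 1 ∧
      18 * L * (Real.sqrt 2 * btRad β + recordDelta1 L s β) ≤ 1 / 2 ∧
      0 ≤ btR1 β / 2 - 2 * (Real.sqrt 2 * btRad β + recordDelta1 L s β) * btEps β - (2 * Real.sqrt 2 * btRad β + btAlpha β) ∧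
      0 ≤ 1 / (3 * L) - 4 * (Real.sqrt 2 * btRad β + recordDelta1 L s β) - (2 * Real.sqrt 2 * btRad β + btAlpha β) ∧
      3 * L * (13 * recordDelta1 L s β) < 1 ∧
      0 ≤ 13 * recordDelta1 L s β - 4 * (Real.sqrt 2 * btRad β + recordDelta1 L s β) - (2 * Real.sqrt 2 * btRad β + 2 * recordDelta1 L s β) ∧
      2 * btEps β * Fintype.card (Site 3 L) * recordDelta1 L s β + 2 * btRad β ^ 2 +
          2 * Real.sqrt 2 * Fintype.card (Site 3 L) * (9 * L * (13 * recordDelta1 L s β) + btEps β) * btRad β ≤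
        Fintype.card (Site 3 L) * (1 - 3 * L * (13 * recordDelta1 L s β)) * btAlpha β)
    (hbudget : ∀ᶠ β : ℝ in atTop, 1 ≤ (L : ℝ) ^ 3 * β ∧ 2 / rStar ^ 3 ≤ (L : ℝ) ^ 3 * β ∧ 2 * (btEps β / 3) < btR1 β ∧
      Real.exp (β * ((Fintype.card (Edge 3 L) : ℝ) * (2 * (btEps β / 3) + 2 * Real.sqrt 2 * btRad β) ^ 2) +
            β * ((10 * Real.sqrt (Fintype.card (Plaquette 3 L × Fin 3)) * btRad β) ^ 2 + stepActionErr (L := L) (btRad β) 0)) *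
          Real.exp (-(β * btMnt L (recordDelta1 L s β) (btAlpha β) (btRad β) (btR1 β) (btEps β))) ≤
        powScale 1 β / 3 * (gaugeMeasure L).real (gaugeCore L (btEps β / 3)) * (Real.exp (-3) * ((L : ℝ) ^ 3 * β) ^ (-(9 : ℝ) / 2) / 2000) ∧
      Real.exp (β * ((Fintype.card (Edge 3 L) : ℝ) * (2 * (btEps β / 3) + 2 * Real.sqrt 2 * btRad β) ^ 2) +
            β * ((10 * Real.sqrt (Fintype.card (Plaquette 3 L × Fin 3)) * btRad β) ^ 2 + stepActionErr (L := L) (btRad β) 0)) *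
          Real.exp (-(β * btMfar L (recordDelta1 L s β) (btAlpha β) (btRad β) (btEps β) (13 * recordDelta1 L s β))) ≤
        powScale 1 β / 3 * (gaugeMeasure L).real (gaugeCore L (btEps β / 3)) * (Real.exp (-3) * ((L : ℝ) ^ 3 * β) ^ (-(9 : ℝ) / 2) / 2000) ∧
      Real.exp (-((L : ℝ) ^ 3 * β * btAlpha β ^ 2)) ≤ powScale 1 β / 3 * (Real.exp (-3) * ((L : ℝ) ^ 3 * β) ^ (-(9 : ℝ) / 2) / 2000)) :
    ∀ᶠ β : ℝ in atTop, ∀ φ : GaugeConfig 3 1 SU2 → ℝ, Measurable φ → (∃ C : ℝ, ∀ u, |φ u| ≤ C) →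
      (∀ (g : Site 3 1 → SU2) (u : GaugeConfig 3 1 SU2), φ (gaugeTransform g u) = φ u) → (∀ u, φ u ≠ 0 → orbitDist u < recordDelta1 L s β) →
      |tubeForm β (boFun L φ (btOmega L β)) - (btConst L β / fpZ (btEps β) / recordGamma L (btOmega L) β) * recordGamma L (btOmega L) β * qform su2Rep ((L : ℝ) ^ 3 * β) φ φ| ≤
        btRate L s β * ((btConst L β / fpZ (btEps β) / recordGamma L (btOmega L) β) * recordGamma L (btOmega L) β) *
          (qform su2Rep ((L : ℝ) ^ 3 * β) φ φ + levelValue su2Rep 1 ((L : ℝ) ^ 3 * β) 0 * l2 φ φ) := by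
  obtain ⟨hΩm, hΩ1, hΩinv, hΩr, hγ⟩ := btOmega_fields (L := L)
  have hW : ∀ β, Measurable (fpWeight L (btEps β)) := fun β => measurable_fpWeight L _
  have hCW : ∀ β g, |fpWeight L (btEps β) g| ≤ 1 := fun β g => abs_fpWeight_le L _ g
  have hZ0 : ∀ β, 0 < fpZ (btEps β) := fun β => fpZ_pos (btEps_pos_le β).1
  have hZ : ∀ β (g : Site 3 L → SU2), ∫ c, fpWeight L (btEps β) (fun x => c * g x) ∂haarProbability SU2 = fpZ (btEps β) := fun β g => fpWeight_orbit L _ g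
  have hC : ∀ β, 0 ≤ btConst L β := fun β => by
    unfold btConst btC
    exact div_nonneg (fpBOKernel_nonneg β (hΩm β) (hΩ1 β) (btOmega_nonneg β) (measurable_coreWeight _ _) (abs_coreWeight_le _ _)
      (fun g => (coreWeight_mem_Icc _ _ g).1) 1 1) (transferKernel_pos _ _ _ _).le
  -- the schedule rates
  set κ : ℝ → ℝ := fun β => btKappa L β (recordDelta1 L s β) (btAlpha β) (9 * L * btR1 β + btEps β) (btRad β) (btEps β * Fintype.card (Site 3 L))
    ((L : ℝ) ^ 3 * (12 * recordDelta1 L s β ^ 4)) with hκdef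
  set τ : ℝ → ℝ := fun β => btTau L β (btOmega L β) (recordDelta1 L s β) (btAlpha β) (btRad β) (btR1 β) (btEps β) (13 * recordDelta1 L s β) (btConst L β) with hτdef
  have hκ0 : ∀ β, 0 ≤ κ β := fun β => by rw [hκdef]; dsimp only; unfold btKappa; positivity
  have hκ₂ : ∀ β, 0 ≤ powScale 1 β := fun β => (powScale_pos _ _).le
  have hτ0 : ∀ β, 0 ≤ τ β := fun β => by rw [hτdef]; dsimp only; unfold btTau; have := hC β; positivity
  -- the two eventual inputs of the door
  have hτZ : ∀ᶠ β : ℝ in atTop, τ β / fpZ (btEps β) ≤ powScale 1 β * (btConst L β / fpZ (btEps β)) * levelValue su2Rep 1 ((L : ℝ) ^ 3 * β) 0 := by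
    filter_upwards [hbudget, eventually_ge_atTop (0 : ℝ)] with β hb hβ
    obtain ⟨hB1, hB2, hρR, H1, H2, H3⟩ := hb
    have hρε : 2 * (btEps β / 3) < btEps β := by linarith [(btEps_pos_le β).1]
    have hρ1 : btEps β / 3 < 1 := by linarith [(btEps_pos_le β).2]
    have h := btTau_le hβ hB1 hB2 (hΩm β) (hΩ1 β) (btOmega_nonneg β) (btOmega_support β) (by linarith [(btRad_pos_le β).2]) (by linarith [(btEps_pos_le β).1])
      hρR hρε hρ1 (hκ₂ β) H1 H2 H3
    rw [hτdef]; dsimp only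
    unfold btConst at h ⊢
    have hZne : fpZ (btEps β) ≠ 0 := (hZ0 β).ne'
    rw [div_le_iff₀ (hZ0 β)]
    calc _ ≤ powScale 1 β * btC L β (btOmega L β) (btEps β) (btR1 β) * levelValue su2Rep 1 ((L : ℝ) ^ 3 * β) 0 := h
      _ = powScale 1 β * (btC L β (btOmega L β) (btEps β) (btR1 β) / fpZ (btEps β)) * levelValue su2Rep 1 ((L : ℝ) ^ 3 * β) 0 * fpZ (btEps β) := by
          field_simp
  have hpt : ∀ᶠ β : ℝ in atTop, ∀ u u' : GaugeConfig 3 1 SU2, orbitDist u < recordDelta1 L s β → orbitDist u' < recordDelta1 L s β →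
      |fpBOKernel L β (btOmega L β) (fpWeight L (btEps β)) u u' - btConst L β * transferKernel su2Rep ((L : ℝ) ^ 3 * β) u u'| ≤
        κ β * btConst L β * transferKernel su2Rep ((L : ℝ) ^ 3 * β) u u' + τ β := by
    filter_upwards [hsmall] with β hsm u u' hu hu'
    obtain ⟨hβ, hδ2, hα1, htT, hT, hσ, hεs, hLa, hm₁, hm₂, hP, hP0, hJ⟩ := hsm
    exact fixed_beta_estimate hβ (hΩm β) (hΩ1 β) (btOmega_nonneg β) (hΩinv β) (btOmega_support β) hδ2 (btAlpha_nonneg β) hα1 (btEps_pos_le β).1.le htT hT hσ hεs hLa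
      hm₁ hm₂ hP hP0 hJ u u' hu hu'
  have hdoor := hT_of_fp_add hs hΩm hΩ1 hΩinv hγ hW hCW hZ0 hZ hC hκ0 hκ₂ hτ0 hτZ hpt
  filter_upwards [hdoor, eventually_ge_atTop (0 : ℝ)] with β hβ hβ0 φ hφm hφb hφg hφs
  have h := hβ φ hφm hφb hφg hφs
  obtain ⟨Cφ, hCφ⟩ := hφb
  have hB : (0 : ℝ) ≤ (L : ℝ) ^ 3 * β := by positivity
  have hQ : 0 ≤ qform su2Rep ((L : ℝ) ^ 3 * β) φ φ + levelValue su2Rep 1 ((L : ℝ) ^ 3 * β) 0 * l2 φ φ := by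
    have hq := qform_self_nonneg_of_bounded hB hφm hCφ
    have hl2 : 0 ≤ l2 φ φ := by rw [l2_self_eq_integral_sq]; exact integral_nonneg fun u => sq_nonneg _
    have hl := levelValue_su2Rep_nonneg 1 hB 0
    positivity
  have hσγ : 0 ≤ btConst L β / fpZ (btEps β) / recordGamma L (btOmega L) β * recordGamma L (btOmega L) β := by
    have := hC β; have := hZ0 β; have := hγ β; positivity
  have hrate : κ β + powScale 1 β ≤ btRate L s β := by
    rw [hκdef]; unfold btRate
    have : 0 ≤ powScale (2 * s) β * btLog β ^ 5 := mul_nonneg (powScale_pos _ _).le (pow_nonneg (le_trans zero_le_one (one_le_btLog β)) 5)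
    linarith
  unfold btConst at h hσγ ⊢
  exact h.trans (mul_le_mul_of_nonneg_right (mul_le_mul_of_nonneg_right hrate hσγ) hQ)

end Summit.QuantumFields.YangMills.Theorems.FemtoTransferGap.TwoLattice.ConstTube

end
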